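import Summits.CriticalPhenomena.CardyFormulaZ2.Theorems.CardyIKTransportCornerLineDescentLine
import Literature.Probability.RandomPlanarGeometry.ConformalMapCaratheodoryProofs
import Literature.Topology.PlaneTopology.CellSchoenflies

/-!
# A Riemann map of a Jordan domain extends to a homeomorphism of the plane
# (`stub_RiemannMapPlaneExtension`, crux `CardyIKTransport.CornerLineDescent`)

Support file (`--supports stmt-CriticalPhenomena-10964`, registered sub-goal `stub_RiemannMapPlaneExtension`) for the
line `symmetric-seed-second-order` of the crux `CardyIKTransport.CornerLineDescent` (lead c4 reshape: tame rectangles +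
the crude-Cardy domain approximation `crudeBondCardy_of_tame`).  THE STUB IS A THEOREM: for every Jordan domain `D` and
every conformal equivalence `ψ : 𝔻 → D` of the open unit disc onto `D` there is a homeomorphism `F : ℂ ≃ₜ ℂ` of the
plane agreeing with `ψ` on the open disc.  It is the "Carathéodory + Schoenflies" step of the line: the neighbouring stub
`stub_TameShrink` conjugates the dilation `z ↦ λ z` by such an `F` to approximate `R` from inside by tame rectangles.

Proof (two landed Literature theorems, no new mathematics):
* Carathéodory's theorem for Jordan domains, disc form
  (`JordanDomain.exists_continuousOn_extension_holds`, Pommerenke (1992) Thm. 2.6): `ψ` extends to `Ψ`, continuous on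
  the closed disc, equal to `ψ` on the open disc, and a bijection of `closedBall 0 1` onto `closure D` — in particular
  injective on `closedBall 0 1 = closure 𝔻`;
* the Schoenflies theorem for `2`-cells (`JordanDomain.exists_homeomorph_eqOn_closure`, Bing (1983) §III.6, applied to
  the Jordan domain `JordanDomain.unitDisc`): a map continuous and injective on the closure of a Jordan domain extends
  to a homeomorphism `H` of `ℂ` agreeing with it on that closure.
Then `H = Ψ = ψ` on the open disc.

References: route file `Theses/CardyIKTransport.lean` (item 10964); Pommerenke, *Boundary Behaviour of Conformal Maps*
(1992), Thm. 2.6 and §2.3 Cor. 2.9; Bing, *The Geometric Topology of 3-Manifolds* (1983), §III.6.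
-/

noncomputable section

namespace Summit.CriticalPhenomena.CardyFormulaZ2.Theorems.CornerLineDescent.SymmetricSeed

open scoped Topology unitInterval
open Filter Set Metric
open Literature.Probability.RandomPlanarGeometry

/-- `stub_RiemannMapPlaneExtension` (registered stub 4 of the line `symmetric-seed-second-order`, PROVED): A RIEMANN MAP
OF A JORDAN DOMAIN EXTENDS TO A HOMEOMORPHISM OF THE PLANE.  For every Jordan domain `D` and every conformal equivalence
`ψ : 𝔻 → D` there is a plane homeomorphism `F` agreeing with `ψ` on the open unit disc.  Carathéodory
(`JordanDomain.exists_continuousOn_extension_holds`: continuous injective extension `Ψ` to the closed disc) followed by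
the Schoenflies theorem for `2`-cells at the unit disc (`JordanDomain.exists_homeomorph_eqOn_closure`). [folklore] -/
theorem stub_RiemannMapPlaneExtension :
    ∀ (D : JordanDomain) (ψ : ConformalEquiv (Metric.ball (0:ℂ) 1) D.carrier),
      ∃ F : ℂ ≃ₜ ℂ, Set.EqOn F ψ (Metric.ball 0 1) := by
  intro D ψ
  obtain ⟨Ψ, hΨc, hΨeq, hΨbij, -⟩ := JordanDomain.exists_continuousOn_extension_holds D ψ
  have hcl : closure JordanDomain.unitDisc.carrier = Metric.closedBall (0:ℂ) 1 := by
    rw [JordanDomain.carrier_unitDisc, closure_ball (0:ℂ) one_ne_zero]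
  obtain ⟨H, hH, -⟩ := JordanDomain.unitDisc.exists_homeomorph_eqOn_closure (f := Ψ)
    (by rw [hcl]; exact hΨc) (by rw [hcl]; exact hΨbij.injOn)
  refine ⟨H, fun z hz => ?_⟩
  have hz' : z ∈ closure JordanDomain.unitDisc.carrier := by
    rw [hcl]
    exact Metric.ball_subset_closedBall hz
  rw [hH hz', hΨeq hz]

end Summit.CriticalPhenomena.CardyFormulaZ2.Theorems.CornerLineDescent.SymmetricSeed
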